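import Summits.Ventures.Crystal3D.Theorems.StickyWulffConstantNoReconstructionGainJointBoundLevelArcs
import Summits.Ventures.Crystal3D.Theorems.StickyWulffConstantNoReconstructionGainJointBoundAzimuth
import HarnessLib

/-!
# Joint level/support bound — geometric lemmas for the `1/20`-level row

HONEST FRAMING. Part of the venture `Summits/Ventures/Crystal3D` (cell `crystal3d-full`), helper
`--supports` the crux `NoReconstructionGain` (stmt-Ventures-19144, route
`route-Ventures-StickyWulffConstant`), line `joint-level-support-bound`, stub
`stub_jointBound_levelHeavy20` (skeleton v2).

* `jb_ruleA_bound` — RULE A: the weighted azimuthal cycle through five `1/20`-level directions and a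
  set `S` of non-polar deep directions with depth bands `bd`, giving
  `5·jbTLL + Σ_S (2·jbTC (bd u) − jbTLL) < 2π·10⁴`.
* `jb_pack` — one-dimensional packing of the level directions whose azimuth lies in an interval
  `[a, b)`: clearances from the two end deep directions plus `(K − 1)` level gaps fit in `b − a`.
* `jb_card_split` — level counts of adjacent azimuth intervals add.

WHAT THIS IS NOT: the stub itself (`…JointBoundLevelHeavy`); rung F-C1 not moved.
-/

noncomputable section

namespace Summit.Ventures.Crystal3D.Theorems

open Finset Real
open Literature.Algebra.EuclideanLattices (inner_fin_three norm_sq_fin_three)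
open scoped InnerProductSpace

/-- Level counts of adjacent azimuth intervals add. -/
theorem jb_card_split (L : Finset (EuclideanSpace ℝ (Fin 3))) (θ : EuclideanSpace ℝ (Fin 3) → ℝ)
    (a b c : ℝ) (hab : a ≤ b) (hbc : b ≤ c) :
    (L.filter fun u => a ≤ θ u ∧ θ u < c).card =
      (L.filter fun u => a ≤ θ u ∧ θ u < b).card + (L.filter fun u => b ≤ θ u ∧ θ u < c).card := by
  classical
  rw [← card_union_of_disjoint]
  · congr 1
    ext u
    simp only [mem_filter, mem_union]
    constructor
    · rintro ⟨hu, h1, h2⟩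
      by_cases h : θ u < b
      · exact Or.inl ⟨hu, h1, h⟩
      · exact Or.inr ⟨hu, not_lt.1 h, h2⟩
    · rintro (⟨hu, h1, h2⟩ | ⟨hu, h1, h2⟩)
      · exact ⟨hu, h1, lt_of_lt_of_le h2 hbc⟩
      · exact ⟨hu, hab.trans h1, h2⟩
  · exact disjoint_left.2 fun u h1 h2 => by
      have := (mem_filter.1 h1).2.2; have := (mem_filter.1 h2).2.1; linarith

/-- **1-D packing of levels in an azimuth interval.**  If the `1/20`-level directions of `L` with
azimuth in `[a, b)` are pairwise more than `jbTLL·10⁻⁴` apart in azimuth, each at least `cj·10⁻⁴`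
above `a` and at least `cj'·10⁻⁴` below `b`, and there is at least one of them, then
`cj + cj' + (K - 1)·jbTLL ≤ 10⁴ (b - a)` where `K` is their number. -/
theorem jb_pack (L : Finset (EuclideanSpace ℝ (Fin 3))) (θ : EuclideanSpace ℝ (Fin 3) → ℝ)
    (a b : ℝ) (cj cj' : ℕ)
    (hLL : ∀ u ∈ L, ∀ v ∈ L, u ≠ v → ((jbTLL : ℕ) : ℝ) / 10000 < |θ u - θ v|)
    (hlo : ∀ u ∈ L, a ≤ θ u → θ u < b → a + (cj : ℝ) / 10000 ≤ θ u)
    (hhi : ∀ u ∈ L, a ≤ θ u → θ u < b → θ u ≤ b - (cj' : ℝ) / 10000)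
    (hK : 1 ≤ (L.filter fun u => a ≤ θ u ∧ θ u < b).card) :
    ((cj : ℝ) + cj') + ((((L.filter fun u => a ≤ θ u ∧ θ u < b).card : ℕ) : ℝ) - 1) * (jbTLL : ℝ)
      ≤ 10000 * (b - a) := by
  classical
  set Λ := L.filter fun u => a ≤ θ u ∧ θ u < b with hΛ
  have hmemΛ : ∀ u ∈ Λ, u ∈ L ∧ a ≤ θ u ∧ θ u < b := fun u hu => by simpa [hΛ] using hu
  -- θ is injective on Λ
  have hinj : Set.InjOn θ ↑Λ := by
    intro u hu v hv huv
    by_contra hne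
    have h := hLL u (hmemΛ u hu).1 v (hmemΛ v hv).1 hne
    rw [huv, sub_self, abs_zero] at h
    have : (0 : ℝ) ≤ ((jbTLL : ℕ) : ℝ) / 10000 := by positivity
    linarith
  set S := Λ.image θ with hS
  have hScard : S.card = Λ.card := card_image_of_injOn hinj
  obtain ⟨n, hn⟩ : ∃ n : ℕ, Λ.card = n + 1 := ⟨Λ.card - 1, by omega⟩
  have hpack := packing_lower_bound (((jbTLL : ℕ) : ℝ) / 10000) (a + (cj : ℝ) / 10000)
    (b - (cj' : ℝ) / 10000) n S (by rw [hScard, hn]) ?_ ?_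
  · have hcast : (((Λ.card : ℕ) : ℝ) - 1) = (n : ℝ) := by rw [hn]; push_cast; ring
    rw [hcast]
    linarith
  · intro x hx
    obtain ⟨u, hu, rfl⟩ := mem_image.1 hx
    have h := hmemΛ u hu
    exact ⟨hlo u h.1 h.2.1 h.2.2, hhi u h.1 h.2.1 h.2.2⟩
  · intro x hx y hy hxy
    obtain ⟨u, hu, rfl⟩ := mem_image.1 hx
    obtain ⟨v, hv, rfl⟩ := mem_image.1 hy
    exact hLL u (hmemΛ u hu).1 v (hmemΛ v hv).1 fun h => hxy (by rw [h])

/-- **RULE A: the weighted level cycle.**  `F` a kissing-separated set of unit vectors, `L5 ⊆ F`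
five `1/20`-level directions, `S ⊆ F` deep directions with positive horizontal radius and depth
bands `bd` (`-jbHi (bd u) ≤ u₂`) all of which are kept (`jbTLL ≤ 2·jbTC (bd u)`).  Then
`5·jbTLL + Σ_S (2·jbTC (bd u) − jbTLL) < 2π·10⁴` (weighted azimuthal cycle based at a level
direction, weights `jbTLL/2` for levels and `jbTC − jbTLL/2` for the deep directions). -/
theorem jb_ruleA_bound (F : Finset (EuclideanSpace ℝ (Fin 3)))
    (hn : ∀ u ∈ F, ‖u‖ = 1) (hsep : ∀ u ∈ F, ∀ v ∈ F, u ≠ v → ⟪u, v⟫_ℝ ≤ 1 / 2)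
    (L5 : Finset (EuclideanSpace ℝ (Fin 3))) (hL5F : L5 ⊆ F) (hL5lev : ∀ u ∈ L5, |u 2| ≤ 1 / 20)
    (hL5card : L5.card = 5)
    (S : Finset (EuclideanSpace ℝ (Fin 3))) (hSF : S ⊆ F) (hSdeep : ∀ u ∈ S, u 2 ≤ -(1 / 2))
    (hSρ : ∀ u ∈ S, 0 < u 0 ^ 2 + u 1 ^ 2)
    (bd : EuclideanSpace ℝ (Fin 3) → ℕ) (hbd : ∀ u ∈ S, bd u < 8 ∧ -((jbHi (bd u) : ℚ) : ℝ) ≤ u 2)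
    (hkept : ∀ u ∈ S, jbTLL ≤ 2 * jbTC (bd u)) :
    5 * ((jbTLL : ℕ) : ℝ) + ∑ u ∈ S, (2 * ((jbTC (bd u) : ℕ) : ℝ) - jbTLL) < 20000 * π := by
  classical
  have hco : ∀ u ∈ F, u 0 ^ 2 + u 1 ^ 2 + u 2 ^ 2 = 1 := fun u hu => by
    rw [← norm_sq_fin_three, hn u hu]; norm_num
  have hnotlev : ∀ u ∈ S, ¬ |u 2| ≤ 1 / 20 := fun u hu h => by
    have := hSdeep u hu; have h' := (abs_le.1 h).1; linarith
  have hdisj : Disjoint L5 S := disjoint_left.2 fun u h1 h2 => hnotlev u h2 (hL5lev u h1)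
  obtain ⟨ℓ₀, hℓ₀⟩ : L5.Nonempty := card_pos.1 (by omega)
  have hℓ₀F := hL5F hℓ₀
  have hℓ₀ρ : 0 < ℓ₀ 0 ^ 2 + ℓ₀ 1 ^ 2 := by
    have h1 := (abs_le.1 (hL5lev ℓ₀ hℓ₀)).1; have h2 := (abs_le.1 (hL5lev ℓ₀ hℓ₀)).2
    nlinarith [hco ℓ₀ hℓ₀F]
  obtain ⟨ρ, θ, hρ, hθ, hθ0, -, hθpair⟩ := exists_azimuth ℓ₀ hℓ₀ρ
  have hzρ : ∀ u ∈ F, u 2 ^ 2 + ρ u ^ 2 = 1 := fun u hu => by rw [(hρ u).2]; linarith [hco u hu]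
  have hpair : ∀ u ∈ F, ∀ v ∈ F, u ≠ v → ∀ x : ℝ, Real.cos x = Real.cos (θ u - θ v) →
      ρ u * ρ v * Real.cos x + u 2 * v 2 ≤ 1 / 2 := by
    intro u hu v hv huv x hx
    rw [hx, hθpair u v, ← inner_fin_three]; exact hsep u hu v hv huv
  set T := (L5.erase ℓ₀) ∪ S with hT
  have hℓ₀T : ℓ₀ ∉ T := by
    rw [hT, mem_union, not_or]
    exact ⟨notMem_erase ℓ₀ L5, fun h => hnotlev ℓ₀ h (hL5lev ℓ₀ hℓ₀)⟩
  have hTne : T.Nonempty := by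
    have : (L5.erase ℓ₀).card = 4 := by rw [card_erase_of_mem hℓ₀, hL5card]
    obtain ⟨v, hv⟩ : (L5.erase ℓ₀).Nonempty := card_pos.1 (by omega)
    exact ⟨v, mem_union_left _ hv⟩
  have hmemT : ∀ u ∈ insert ℓ₀ T, u ∈ L5 ∨ u ∈ S := by
    intro u hu
    rcases mem_insert.1 hu with rfl | hu
    · exact Or.inl hℓ₀
    · rcases mem_union.1 hu with hu | hu
      · exact Or.inl (mem_of_mem_erase hu)
      · exact Or.inr hu
  -- weights (units of radians)
  let w : EuclideanSpace ℝ (Fin 3) → ℝ := fun u =>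
    if |u 2| ≤ 1 / 20 then ((jbTLL : ℕ) : ℝ) / 20000
    else (((jbTC (bd u) : ℕ) : ℝ) - ((jbTLL : ℕ) : ℝ) / 2) / 10000
  have hwL : ∀ u ∈ L5, w u = ((jbTLL : ℕ) : ℝ) / 20000 := fun u hu => by
    show (if |u 2| ≤ 1 / 20 then _ else _) = _; rw [if_pos (hL5lev u hu)]
  have hwD : ∀ u ∈ S, w u = (((jbTC (bd u) : ℕ) : ℝ) - ((jbTLL : ℕ) : ℝ) / 2) / 10000 := fun u hu => by
    show (if |u 2| ≤ 1 / 20 then _ else _) = _; rw [if_neg (hnotlev u hu)]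
  have key := weighted_cycle_finset ℓ₀ T hTne hℓ₀T θ w hθ0 hθ ?_
  · -- evaluate
    have hsum : ∑ u ∈ T, w u = 4 * (((jbTLL : ℕ) : ℝ) / 20000) +
        ∑ u ∈ S, (((jbTC (bd u) : ℕ) : ℝ) - ((jbTLL : ℕ) : ℝ) / 2) / 10000 := by
      rw [hT, sum_union (disjoint_of_subset_left (erase_subset _ _) hdisj)]
      rw [sum_congr rfl fun u hu => hwL u (mem_of_mem_erase hu), sum_congr rfl fun u hu => hwD u hu]
      rw [sum_const, card_erase_of_mem hℓ₀, hL5card]; norm_num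
    rw [hsum, hwL ℓ₀ hℓ₀] at key
    have : ∑ u ∈ S, (((jbTC (bd u) : ℕ) : ℝ) - ((jbTLL : ℕ) : ℝ) / 2) / 10000 =
        (∑ u ∈ S, (2 * ((jbTC (bd u) : ℕ) : ℝ) - jbTLL)) / 20000 := by
      rw [Finset.sum_div]; refine sum_congr rfl fun u _ => ?_; ring
    rw [this] at key
    nlinarith [key]
  · -- gap bounds
    intro u hu v hv huv x hx hcx
    have huF : u ∈ F := by rcases hmemT u hu with h | h; exact hL5F h; exact hSF h
    have hvF : v ∈ F := by rcases hmemT v hv with h | h; exact hL5F h; exact hSF h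
    have hs := hpair u huF v hvF huv x hcx
    have hs' : ρ v * ρ u * Real.cos x + v 2 * u 2 ≤ 1 / 2 := by linarith
    have h1u := hzρ u huF
    have h1v := hzρ v hvF
    rcases hmemT u hu with huL | huS <;> rcases hmemT v hv with hvL | hvS
    · -- level–level
      rw [hwL u huL, hwL v hvL]
      have := jb_arcLL (u 2) (v 2) (ρ u) (ρ v) x (hL5lev u huL) (hL5lev v hvL) (hρ u).1 (hρ v).1
        h1u h1v hx hs
      linarith
    · -- level–deep
      rw [hwL u huL, hwD v hvS]
      have hk := hkept v hvS
      have hb0 : jbTC (bd v) ≠ 0 := by intro h; rw [h] at hk; simp [jbTLL] at hk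
      have := jb_arcC_lt (bd v) (hbd v hvS).1 hb0 (v 2) (u 2) (ρ v) (ρ u) x (hSdeep v hvS)
        (hbd v hvS).2 (hL5lev u huL) (hρ v).1 (hρ u).1 h1v h1u hx hs'
      linarith
    · -- deep–level
      rw [hwD u huS, hwL v hvL]
      have hk := hkept u huS
      have hb0 : jbTC (bd u) ≠ 0 := by intro h; rw [h] at hk; simp [jbTLL] at hk
      have := jb_arcC_lt (bd u) (hbd u huS).1 hb0 (u 2) (v 2) (ρ u) (ρ v) x (hSdeep u huS)
        (hbd u huS).2 (hL5lev v hvL) (hρ u).1 (hρ v).1 h1u h1v hx hs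
      linarith
    · -- deep–deep
      rw [hwD u huS, hwD v hvS]
      have hρu : 0 < ρ u := by
        have := (hρ u).2; nlinarith [(hρ u).1, hSρ u huS]
      have hρv : 0 < ρ v := by
        have := (hρ v).2; nlinarith [(hρ v).1, hSρ v hvS]
      have := arc_gt_deep_deep 0.336 1.228 (1 / 2) (u 2) (v 2) (ρ u) (ρ v) x (by norm_num)
        cos_tdd_gt (by linarith [Real.pi_gt_three]) (by norm_num) (by norm_num) (hSdeep u huS)
        (hSdeep v hvS) hρu hρv h1u h1v hx hs
      have hcu : ((jbTC (bd u) : ℕ) : ℝ) ≤ 8767 := by exact_mod_cast jbTC_le (bd u)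
      have hcv : ((jbTC (bd v) : ℕ) : ℝ) ≤ 8767 := by exact_mod_cast jbTC_le (bd v)
      have htll : ((jbTLL : ℕ) : ℝ) = 10408 := by norm_num [jbTLL]
      rw [htll]
      linarith

end Summit.Ventures.Crystal3D.Theorems

end
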